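import Literature.MathematicalPhysics.QuantumFieldTheory.Balaban1983to89.B15Prop1CarrierOnSU2BoxExt193
import Literature.MathematicalPhysics.QuantumFieldTheory.Balaban1983to89.B5Bounds167Lattice

/-!
# `Balaban1983to89.B15Prop1SliceIneq167` — (1.67) [10] = [Balaban1984PropagatorsI] CONSUMED BY NAME at the `x₁`-slice of record of
# [Balaban1989LargeFieldI] Proposition 1 p. 194 (proof [Balaban1989LargeFieldII] pp. 357–359): the (1.7) letter of the N12∕s1 chain
# reduced to print's identification of the leading quadratic form

statement-level skeleton of published theorems with citation tags; proofs where landed; nothing here is a claim about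
the Yang–Mills mass gap

T. Bałaban, *Large field renormalization. II*, Commun. Math. Phys. **122** (1989) 355–392 [Balaban1989LargeFieldII], p. 357 foot –
p. 358 top (PDF held `paper:balaban1989-cmp122-large-field-ii`, journal page = PDF page + 354), verbatim: *"Now the leading quadratic
form is equal to ⟨B′, Δ_kB′⟩ defined by (1.65), (1.66) [10].  Using the bound (1.67) [10] for this form, we obtain
⟨H_{1,k}B′, Δ₁(ζ₀)H_{1,k}B′⟩ ≧ γ₀‖∂B′‖² − O(1)(M⁶R_kε_k + exp(−R_k))‖B′‖².  (1.7)"*; T. Bałaban, *Propagators and renormalization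
transformations for lattice gauge theories. I*, Commun. Math. Phys. **95** (1984) 17–40 [Balaban1984PropagatorsI] (= [10]), (1.67)
p. 29: *"γ₀⟨∂₁B, ∂₁B⟩ ≦ ⟨B, Δ_kB⟩ ≦ γ₁⟨∂₁B, ∂₁B⟩"* — IN THE TREE as r02's `B5Bounds167Lattice.ineq167` (unit torus
`Tor M × Fin d → ℂ`, explicit `γ₀ = (4/π²)^{d+2}`, `⟨B, Δ_kB⟩` := the third expression of (1.66), `formDk`).

Cell pub-ymgap, HUMAN RULING D-0062 (Track A full width), seat `pub-ymgap-dag-n12-c` (R134 acceleration seat (a), strategy s1 of DAG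
node N12 = [B15], director's row *«INHABIT `B15.Prop1Printed` from the landed p.359 model (… `bounds167_*` …)»*; generation g3,
third product).

WHAT THIS FILE PROVES (theorems only; Mathlib + the two imports; no `sorry`, no definition, no `… : Prop` fact; axioms standard).
§1 TORUS DICTIONARY (r02's carrier `Tor N × Fin d → ℂ`; private [folklore] `shiftM_mulVec`): `fdiff_one_mulVec` ((1.31) with
   `c = 1`), `tcurl_apply` (r02's curl unfolded), `tcurl_antisymm`, **`sum_axial_le_d1Sq`** (`Σ_μ Σ_x |(∂₁B)_{j₀μ}(x)|² ≤ ⟨∂₁B, ∂₁B⟩`).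
§2 THE SLICE OF RECORD (`Site P k` IS `Tor (fun _ => sitesPerDir k)` definitionally; private `castSite_add_unitVec`,
   `sum_box_castSite_le_sum_univ`): `tcurl_ofRealCfg_castSite` (r02's torus curl of a component of a bond field at `castSite z` =
   the `ℤ^d` circulation `B6TreeGaugePoincare.curl` of its pull-back — the circulation of `B15Prop1SliceIneq18.sliceNormSq_le`),
   **`circ_le_sum_formDk`**: `(4/π²)^{d+2} · Σ_{z ∈ window} Σ_μ Σ_a (∂B′_a)(castSite z; e₁, e_μ)² ≤ Σ_{a ∈ Fin 3} ⟨B′_a, Δ_kB′_a⟩` for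
   every `ℝ³`-valued bond field `B′`, every non-wrapping window, every step parameter `n′ ≥ 1` — (1.67) BY NAME per component.
§3 `ineq17_of_lead` (the arithmetic of p. 357–358: leading form ≥ γ₀·circulation and |form − leading form| ≤ C_err‖B′‖² ⇒ (1.7)).
§4 **`prop1Printed_lfVarOn_su2_box_G0_of_167`** — `B15.Prop1Printed (lfVarOn su2Chart I)` for box instances at `SU(2)` EXACTLY as
   `B15Prop1CarrierOnSU2BoxExt193.prop1Printed_lfVarOn_su2_box_G0_of_17_ext193` (p480805), except that the (1.7) letter `h17` is
   REPLACED by print's identification letter `hlead : |⟨H B′, Δ₁H B′⟩ − Σ_a ⟨(ιA B′)_a, Δ_k(ιA B′)_a⟩| ≤ C_err‖B′‖²` (the p. 357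
   expansion in `A₀` and the replacement of the minimizer ∕ `ζ₀`: located hypotheses (a)+(b)+(c) of r13's `B16Ineq17Assembly`) with
   (1.67) now CONSUMED, and `γ₀ := (4/π²)^{d+2}` explicit in the smallness `hsm` and the bookkeeping `hγle`.

HONEST SCOPE.  (i) `⟨B, Δ_kB⟩` is r02's `formDk` (the Fourier-side third expression of (1.66); its identity with (1.65) is r02's
declared caveat).  (ii) The identification letter `hlead` IS the content of p. 357 (Sect. F [15] representation, Sect. B [13]
expansion, exponential decay of the minimizer) at NODE 00's `H_{1,k}`, `Δ₁(ζ₀)` of record — not touched.  (iii) Remaining hypotheses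
of the N12∕s1 chain after this file: `hlead` + `hsm`∕`hγle`, (m2)–(m5)+(c3), (c3″), (x), `hdom`, thresholds.  Count-neutral; NOT a
discharge of N12; NOT summit progress.
-/

noncomputable section

open Set Finset
open scoped BigOperators Matrix RealInnerProductSpace Real

namespace Literature.MathematicalPhysics.QuantumFieldTheory.Balaban1983to89.B15Prop1SliceIneq167

open B15DeterminingSets GaugeField B16Sect1Backgrounds B15Prop1Carrier B8Eq17ClassAkV1
open B15Prop1CarrierOnSU2Box B15Prop1SliceIneq18 B15Prop1CarrierOnSU2BoxIneq19 B15Prop1CarrierOnSU2BoxExt193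
open T4CubeChartGnomonic (SU2)
open B15Prop1ChartSU2 (su2Chart)
open B15Prop1SliceCoordinates (GaugeSlice ιA freeBonds)
open T4AxialGaugeSmallField (castSite castSite_apply castSite_add_e castSite_injOn_box boxPlaqs)
open B7Prop1Explicit (e e_apply)
open B6BondElimination (unitVec unitVec_apply)
open B6TreeGaugePoincare (curl)
open B16Eq18Proof (box mem_box)
open B15Extension193 (extend)
open B15ShellGauge193 (shellGauge)
open B5Prop11Plancherel (Tor shiftM fdiff)
open B5Bounds167Lattice (d1Sq formDk ofRealCfg ineq167)

/-! ## §1  Torus dictionary: r02's forward differences and curl, unfolded; the torus of `Setup` -/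

section Torus

variable {d : ℕ} (N : Fin d → ℕ) [∀ μ, NeZero (N μ)]

/-- The shift matrix acts by translation: `(S_ν B)(x, κ) = B(x + e_ν, κ)`. [folklore] -/
private theorem shiftM_mulVec (ν : Fin d) (B : Tor N × Fin d → ℂ) (i : Tor N × Fin d) :
    (shiftM N ν *ᵥ B) i = B (i.1 + B5Prop11Plancherel.unitVec N ν, i.2) := by
  classical
  simp only [Matrix.mulVec, dotProduct, shiftM, ite_mul, one_mul, zero_mul, Finset.sum_ite_eq', Finset.mem_univ,
    if_true]

/-- The unit forward difference: `(∇_ν B)(x, κ) = B(x + e_ν, κ) − B(x, κ)` ((1.31) [10] with `c = 1`).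
[cite: Balaban1984PropagatorsI, (1.31) p.23] -/
theorem fdiff_one_mulVec (ν : Fin d) (B : Tor N × Fin d → ℂ) (i : Tor N × Fin d) :
    (fdiff N (1 : ℂ) ν *ᵥ B) i = B (i.1 + B5Prop11Plancherel.unitVec N ν, i.2) - B i := by
  rw [fdiff, one_smul, Matrix.sub_mulVec, Matrix.one_mulVec, Pi.sub_apply, shiftM_mulVec]

/-- r02's torus curl, unfolded: `(∂₁B)_{μν}(x) = (B_ν(x + e_μ) − B_ν(x)) − (B_μ(x + e_ν) − B_μ(x))`.
[cite: Balaban1984PropagatorsI, (1.66) p.29] -/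
theorem tcurl_apply (B : Tor N × Fin d → ℂ) (μ ν : Fin d) (x : Tor N) :
    B5Bounds167Lattice.curl N B μ ν x =
      (B (x + B5Prop11Plancherel.unitVec N μ, ν) - B (x, ν)) - (B (x + B5Prop11Plancherel.unitVec N ν, μ) - B (x, μ)) := by
  unfold B5Bounds167Lattice.curl
  rw [fdiff_one_mulVec, fdiff_one_mulVec]

/-- The curl is antisymmetric in its two directions. [cite: Balaban1984PropagatorsI, (1.66) p.29] -/
theorem tcurl_antisymm (B : Tor N × Fin d → ℂ) (μ ν : Fin d) (x : Tor N) :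
    B5Bounds167Lattice.curl N B μ ν x = -B5Bounds167Lattice.curl N B ν μ x := by
  rw [tcurl_apply, tcurl_apply]
  ring

/-- **The axial part of `⟨∂₁B, ∂₁B⟩`**: for one direction `j₀`, `Σ_μ Σ_x |(∂₁B)_{j₀μ}(x)|² ≤ d1Sq B`
(`d1Sq = ½ Σ_{μ,ν} Σ_x |(∂₁B)_{μν}(x)|²` over ordered pairs; antisymmetry, `(∂₁B)_{j₀j₀} = 0`).
[cite: Balaban1984PropagatorsI, (1.66)–(1.67) p.29] -/
theorem sum_axial_le_d1Sq (B : Tor N × Fin d → ℂ) (j₀ : Fin d) :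
    ∑ μ, ∑ x, ‖B5Bounds167Lattice.curl N B j₀ μ x‖ ^ 2 ≤ d1Sq N B := by
  unfold d1Sq
  set F : Fin d → Fin d → ℝ := fun μ ν => ∑ x, ‖B5Bounds167Lattice.curl N B μ ν x‖ ^ 2 with hF
  have hF0 : ∀ μ ν, 0 ≤ F μ ν := fun _ _ => Finset.sum_nonneg fun _ _ => by positivity
  have hsymm : ∀ μ ν, F μ ν = F ν μ := fun μ ν =>
    Finset.sum_congr rfl fun x _ => by rw [tcurl_antisymm N B μ ν x, norm_neg]
  have hdiag : F j₀ j₀ = 0 := by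
    refine Finset.sum_eq_zero fun x _ => ?_
    have : B5Bounds167Lattice.curl N B j₀ j₀ x = 0 := by rw [tcurl_apply]; ring
    rw [this, norm_zero]
    ring
  show ∑ μ, F j₀ μ ≤ 1 / 2 * ∑ μ, ∑ ν, F μ ν
  have h1 : ∀ μ, F μ j₀ ≤ ∑ ν, F μ ν := fun μ =>
    Finset.single_le_sum (fun ν _ => hF0 μ ν) (Finset.mem_univ j₀)
  have h2 : ∑ μ, ∑ ν, F μ ν = ∑ ν, F j₀ ν + ∑ μ ∈ Finset.univ.erase j₀, ∑ ν, F μ ν :=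
    (Finset.add_sum_erase _ (fun μ => ∑ ν, F μ ν) (Finset.mem_univ j₀)).symm
  have h3 : ∑ μ ∈ Finset.univ.erase j₀, F μ j₀ ≤ ∑ μ ∈ Finset.univ.erase j₀, ∑ ν, F μ ν :=
    Finset.sum_le_sum fun μ _ => h1 μ
  have h4 : ∑ μ ∈ Finset.univ.erase j₀, F μ j₀ = ∑ μ, F j₀ μ := by
    rw [← Finset.add_sum_erase _ (fun μ => F j₀ μ) (Finset.mem_univ j₀), hdiag, zero_add]
    exact Finset.sum_congr rfl fun μ _ => hsymm μ j₀
  linarith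

end Torus

/-! ## §2  The `x₁`-slice of record: the window circulation sum is dominated by `Σ_a ⟨B′_a, Δ_kB′_a⟩` ((1.67) [10]) -/

section Slice

variable {P : Params} {k : ℕ}

/-- `castSite` intertwines the unit vectors of `ℤ^d` and of the torus of `Setup` read as r02's `Tor`. [folklore] -/
private theorem castSite_add_unitVec (z : Fin P.d → ℤ) (j : Fin P.d) :
    @HAdd.hAdd (Tor (fun _ : Fin P.d => P.sitesPerDir k)) (Tor (fun _ : Fin P.d => P.sitesPerDir k))
        (Tor (fun _ : Fin P.d => P.sitesPerDir k)) _ (castSite (j := k) z)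
        (B5Prop11Plancherel.unitVec (fun _ : Fin P.d => P.sitesPerDir k) j) =
      castSite (j := k) (z + unitVec j) := by
  funext κ
  by_cases h : κ = j
  · subst h
    simp [castSite_apply, unitVec_apply, B5Prop11Plancherel.unitVec]
  · simp [castSite_apply, unitVec_apply, B5Prop11Plancherel.unitVec, h]

/-- **DICTIONARY**: r02's torus curl of a real component of an `ℝ³`-valued bond field of `Setup`, at the image `castSite z` of an integer point,
IS the `ℤ^d` plaquette circulation `B6TreeGaugePoincare.curl` of its pull-back — the circulation of
`B15Prop1SliceIneq18.sliceNormSq_le`. [cite: Balaban1984PropagatorsI, (1.66) p.29; Balaban1989LargeFieldII, (1.8) p.358] -/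
theorem tcurl_ofRealCfg_castSite (A : VecField P k (EuclideanSpace ℝ (Fin 3))) (a : Fin 3) (z : Fin P.d → ℤ)
    (j μ : Fin P.d) :
    B5Bounds167Lattice.curl (fun _ : Fin P.d => P.sitesPerDir k)
        (ofRealCfg (fun _ : Fin P.d => P.sitesPerDir k) fun i => A ⟨i.1, i.2⟩ a) j μ (castSite z) =
      ((curl (fun b => A ⟨castSite b.1, b.2⟩ a) z j μ : ℝ) : ℂ) := by
  rw [tcurl_apply, curl, castSite_add_unitVec z j, castSite_add_unitVec z μ]
  simp only [ofRealCfg]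
  push_cast
  ring

/-- **WINDOW → TORUS**: a non-negative function summed over the `castSite`-image of an integer box with at most `sitesPerDir`
sites per direction (no wrapping, so `castSite` is injective on it) is at most its sum over the whole torus. [folklore] -/
private theorem sum_box_castSite_le_sum_univ {m : Fin P.d → ℕ} (lo : Fin P.d → ℤ) (hm : ∀ κ, (m κ : ℤ) ≤ P.sitesPerDir k)
    (g : Tor (fun _ : Fin P.d => P.sitesPerDir k) → ℝ) (hg : ∀ x, 0 ≤ g x) :
    ∑ z ∈ box m lo, g (castSite (j := k) z) ≤ ∑ x : Tor (fun _ : Fin P.d => P.sitesPerDir k), g x := by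
  classical
  have hinj : Set.InjOn (fun z : Fin P.d → ℤ => castSite (P := P) (j := k) z) ↑(box m lo) := by
    intro x hx x' hx' h
    rw [Finset.mem_coe, mem_box] at hx hx'
    refine castSite_injOn_box (j := k) (lo := lo) (hi := fun κ => lo κ + m κ - 1) (fun κ => ?_)
      (fun κ => (hx κ).1) (fun κ => ?_) (fun κ => (hx' κ).1) (fun κ => ?_) h
    · have := hm κ
      show lo κ + (m κ : ℤ) - 1 - lo κ < (P.sitesPerDir k : ℤ)
      omega
    · have := (hx κ).2
      show x κ ≤ lo κ + (m κ : ℤ) - 1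
      omega
    · have := (hx' κ).2
      show x' κ ≤ lo κ + (m κ : ℤ) - 1
      omega
  rw [← Finset.sum_image hinj]
  exact Finset.sum_le_univ_sum_of_nonneg hg

/-- **(1.67) [10] AT THE SLICE OF RECORD**: for every bond field `A` with values in `ℝ³` (the Lie algebra coordinates of `su(2)`),
every window `box m lo` without wrapping, every step parameter `n′ ≥ 1`, the `x₁`-axial window circulation sum of
`B15Prop1SliceIneq18.sliceNormSq_le` is dominated, with (1.67)'s `γ₀ = (4/π²)^{d+2}`, by the sum over the three components of
r02's `⟨B′_a, Δ_kB′_a⟩` (`B5Bounds167Lattice.formDk`, the third expression of (1.66) [10]) — `B5Bounds167Lattice.ineq167` BY NAME,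
component by component. [cite: Balaban1984PropagatorsI, (1.67) p.29; Balaban1989LargeFieldII, (1.7) p.358] -/
theorem circ_le_sum_formDk (h0 : 0 < P.d) {n' : ℕ} (hn' : 1 ≤ n') {m : Fin P.d → ℕ} (lo : Fin P.d → ℤ)
    (hm : ∀ κ, (m κ : ℤ) ≤ P.sitesPerDir k) (A : VecField P k (EuclideanSpace ℝ (Fin 3))) :
    (4 / Real.pi ^ 2) ^ (P.d + 2) *
        ∑ z ∈ box m lo, ∑ μ : Fin P.d, ∑ a : Fin 3, curl (fun b => A ⟨castSite b.1, b.2⟩ a) z ⟨0, h0⟩ μ ^ 2 ≤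
      ∑ a : Fin 3, formDk n' (fun _ : Fin P.d => P.sitesPerDir k)
        (ofRealCfg (fun _ : Fin P.d => P.sitesPerDir k) fun i => A ⟨i.1, i.2⟩ a) := by
  haveI : NeZero n' := ⟨by omega⟩
  have hre : ∑ z ∈ box m lo, ∑ μ : Fin P.d, ∑ a : Fin 3, curl (fun b => A ⟨castSite b.1, b.2⟩ a) z ⟨0, h0⟩ μ ^ 2 =
      ∑ a : Fin 3, ∑ μ : Fin P.d, ∑ z ∈ box m lo, curl (fun b => A ⟨castSite b.1, b.2⟩ a) z ⟨0, h0⟩ μ ^ 2 :=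
    calc ∑ z ∈ box m lo, ∑ μ : Fin P.d, ∑ a : Fin 3, curl (fun b => A ⟨castSite b.1, b.2⟩ a) z ⟨0, h0⟩ μ ^ 2
        = ∑ z ∈ box m lo, ∑ a : Fin 3, ∑ μ : Fin P.d, curl (fun b => A ⟨castSite b.1, b.2⟩ a) z ⟨0, h0⟩ μ ^ 2 :=
          Finset.sum_congr rfl fun _ _ => Finset.sum_comm
      _ = ∑ a : Fin 3, ∑ z ∈ box m lo, ∑ μ : Fin P.d, curl (fun b => A ⟨castSite b.1, b.2⟩ a) z ⟨0, h0⟩ μ ^ 2 :=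
          Finset.sum_comm
      _ = ∑ a : Fin 3, ∑ μ : Fin P.d, ∑ z ∈ box m lo, curl (fun b => A ⟨castSite b.1, b.2⟩ a) z ⟨0, h0⟩ μ ^ 2 :=
          Finset.sum_congr rfl fun _ _ => Finset.sum_comm
  rw [hre, Finset.mul_sum]
  refine Finset.sum_le_sum fun a _ => ?_
  set Ba : Tor (fun _ : Fin P.d => P.sitesPerDir k) × Fin P.d → ℂ := ofRealCfg (fun _ : Fin P.d => P.sitesPerDir k) fun i => A ⟨i.1, i.2⟩ a with hBa
  have hwin : ∑ μ : Fin P.d, ∑ z ∈ box m lo, curl (fun b => A ⟨castSite b.1, b.2⟩ a) z ⟨0, h0⟩ μ ^ 2 ≤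
      ∑ μ : Fin P.d, ∑ x : Tor (fun _ : Fin P.d => P.sitesPerDir k), ‖B5Bounds167Lattice.curl (fun _ : Fin P.d => P.sitesPerDir k) Ba ⟨0, h0⟩ μ x‖ ^ 2 := by
    refine Finset.sum_le_sum fun μ _ => ?_
    have hle := sum_box_castSite_le_sum_univ lo hm (fun x => ‖B5Bounds167Lattice.curl (fun _ : Fin P.d => P.sitesPerDir k) Ba ⟨0, h0⟩ μ x‖ ^ 2)
      fun x => by positivity
    refine le_trans (le_of_eq (Finset.sum_congr rfl fun z _ => ?_)) hle
    rw [hBa, tcurl_ofRealCfg_castSite A a z ⟨0, h0⟩ μ, Complex.norm_real, Real.norm_eq_abs, sq_abs]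
  calc (4 / Real.pi ^ 2) ^ (P.d + 2) *
          ∑ μ : Fin P.d, ∑ z ∈ box m lo, curl (fun b => A ⟨castSite b.1, b.2⟩ a) z ⟨0, h0⟩ μ ^ 2
      ≤ (4 / Real.pi ^ 2) ^ (P.d + 2) * ∑ μ : Fin P.d, ∑ x : Tor (fun _ : Fin P.d => P.sitesPerDir k), ‖B5Bounds167Lattice.curl (fun _ : Fin P.d => P.sitesPerDir k) Ba ⟨0, h0⟩ μ x‖ ^ 2 :=
        mul_le_mul_of_nonneg_left hwin (by positivity)
    _ ≤ (4 / Real.pi ^ 2) ^ (P.d + 2) * d1Sq (fun _ : Fin P.d => P.sitesPerDir k) Ba :=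
        mul_le_mul_of_nonneg_left (sum_axial_le_d1Sq (fun _ : Fin P.d => P.sitesPerDir k) Ba ⟨0, h0⟩) (by positivity)
    _ ≤ formDk n' (fun _ : Fin P.d => P.sitesPerDir k) Ba := (ineq167 n' (fun _ : Fin P.d => P.sitesPerDir k) hn' Ba).1

end Slice

/-! ## §3  The arithmetic of (1.7) -/

/-- **p. 357–358, the last step of (1.7)**: if the leading form dominates `γ₀`·(circulation) ((1.67) [10]) and the full form differs
from the leading form by at most `C_err‖B′‖²` (the two perturbation errors), then `γ₀·circ − C_err‖B′‖² ≤ ⟨H B′, Δ₁H B′⟩`.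
[cite: Balaban1989LargeFieldII, (1.7) p.358] -/
theorem ineq17_of_lead {Q F circ C nX γ₀ : ℝ} (hlead : |Q - F| ≤ C * nX) (h167 : γ₀ * circ ≤ F) :
    γ₀ * circ - C * nX ≤ Q := by
  have h := (abs_le.1 hlead).1
  linarith

/-! ## §4  Proposition 1 at the carrier of record with (1.67) consumed -/

section Knit

variable {P : Params}

/-- **PROPOSITION 1 [IV] AT THE CARRIER OF RECORD — `SU(2)`, BOXES, `T = G₀`, PRINTED CHART, SLICE COORDINATES, p. 193 EXTENSION —
WITH (1.67) [10] CONSUMED BY NAME.**  As `B15Prop1CarrierOnSU2BoxExt193.prop1Printed_lfVarOn_su2_box_G0_of_17_ext193` except that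
its (1.7) letter `h17` is supplied from print's identification letter `hlead` (*"the leading quadratic form is equal to
⟨B′, Δ_kB′⟩ defined by (1.65), (1.66) [10]"* up to the errors *"O(1)(M⁶R_kε_k + exp(−R_k))‖B′‖²"*) through `circ_le_sum_formDk`
(= `B5Bounds167Lattice.ineq167` per `su(2)` component, on the window of `sliceNormSq_le`), `γ₀ = (4/π²)^{d+2}`.
[cite: Balaban1989LargeFieldI, Prop. 1 (1.77)–(1.78) p.194; Balaban1989LargeFieldII, (1.7)–(1.9) p.358, pp.358–359;
Balaban1984PropagatorsI, (1.67) p.29] -/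
theorem prop1Printed_lfVarOn_su2_box_G0_of_167 (hd3 : 3 ≤ P.d) (h0 : 0 < P.d) {ι : Type} (I : ι → InstOn P SU2)
    [∀ i, DecidableEq (PBond P (I i).k)]
    (T : ∀ i, Finset (PBond P (I i).k))
    {F : ι → Type*} [∀ i, NormedAddCommGroup (F i)] [∀ i, InnerProductSpace ℝ (F i)]
    (H : ∀ i, GaugeField P (I i).k SU2 →
      (GaugeSlice (pts (I i).k (I i).Λ) (T i) (EuclideanSpace ℝ (Fin 3)) →ₗ[ℝ] F i))
    (Hst : ∀ i, GaugeField P (I i).k SU2 →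
      (F i →ₗ[ℝ] GaugeSlice (pts (I i).k (I i).Λ) (T i) (EuclideanSpace ℝ (Fin 3))))
    (hadj : ∀ i Vk (x : GaugeSlice (pts (I i).k (I i).Λ) (T i) (EuclideanSpace ℝ (Fin 3))) (y : F i),
      ⟪H i Vk x, y⟫ = ⟪x, Hst i Vk y⟫)
    (Δ₁ : ∀ i, GaugeField P (I i).k SU2 → (F i →ₗ[ℝ] F i)) (dV : ∀ i, GaugeField P (I i).k SU2 → F i → F i)
    (J : ∀ i, GaugeField P (I i).k SU2 → F i)
    (lo hi : ι → Fin P.d → ℤ) (n : ι → ℕ) (hn : ∀ i κ, hi i κ ≤ lo i κ + n i) (hN : ∀ i, n i + 2 < P.sitesPerDir (I i).k)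
    (hbox : ∀ i, pts (I i).k (I i).Λ = (castSite '' Set.Icc (lo i) (hi i) : Set (Site P (I i).k)))
    (hZ : ∀ i, (boxPlaqs (lo i - 1) (hi i + 1) : Set (Plaq P (I i).k)) ⊆ plaqsInside (pts (I i).k (I i).Z))
    (hTG0 : ∀ i, T i = (box (fun κ => (hi i κ - lo i κ + 1).toNat) (lo i)).image fun x =>
      (⟨castSite (x - unitVec ⟨0, h0⟩), ⟨0, h0⟩⟩ : PBond P (I i).k))
    (hN5 : ∀ i κ, ((hi i κ - lo i κ + 1).toNat : ℤ) + 5 < P.sitesPerDir (I i).k)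
    (K : ι → ℕ) (hK1 : ∀ i, 1 ≤ K i) (hKn : ∀ i κ, (hi i κ - lo i κ + 1).toNat ≤ K i)
    (ext : ∀ i, GaugeField P (I i).k SU2 → GaugeField P (I i).k SU2)
    -- (ℓ2) REPLACED: the extension is r12's p. 193 shell-gauge extension, `Λ` non-degenerate, constant bookkeeping `hbxM`
    (hext : ∀ i Vk, ext i Vk = extend (pts (I i).k (I i).Λ) (shellGauge Vk (lo i) (hi i)) Vk)
    (hlohi : ∀ i, lo i ≤ hi i)
    {γ h₁ hst cJ bx : ℝ} (hγ : 0 < γ) (hh₁ : 0 ≤ h₁) (hhst : 0 ≤ hst) (hcJ : 0 ≤ cJ) (hbx : 0 ≤ bx)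
    (hbxM : ∀ i, 12 * (P.d : ℝ) * ((n i : ℝ) + 2) ^ 2 ≤ bx * (I i).M ^ 2)
    {ℓ ρ r eA eD a₁ δc Cerr : ι → ℝ} (hℓ : ∀ i, 0 ≤ ℓ i) (hr : ∀ i, 0 < r i) (heA : ∀ i, 0 < eA i) (heD : ∀ i, 0 < eD i)
    (hδc : ∀ i, 0 < δc i) (ha₁ : ∀ i, 0 ≤ a₁ i) (hM : ∀ i, 1 ≤ (I i).M)
    -- (1.7) REPLACED: (1.67) [10] is consumed BY NAME (γ₀ = (4/π²)^{d+2}); what stays is the p. 357 identification of the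
    -- leading form with Σ_a ⟨B′_a, Δ_kB′_a⟩ of (1.65)–(1.66) [10] up to the two perturbation errors (`hlead`)
    (n' : ι → ℕ) (hn' : ∀ i, 1 ≤ n' i)
    (hlead : ∀ i Vk (X : GaugeSlice (pts (I i).k (I i).Λ) (T i) (EuclideanSpace ℝ (Fin 3))),
      |⟪H i Vk X, Δ₁ i Vk (H i Vk X)⟫ -
          ∑ a : Fin 3, formDk (n' i) (fun _ : Fin P.d => P.sitesPerDir (I i).k)
            (ofRealCfg (fun _ : Fin P.d => P.sitesPerDir (I i).k) fun j =>
              ιA (pts (I i).k (I i).Λ) (T i) X ⟨j.1, j.2⟩ a)| ≤ Cerr i * ‖X‖ ^ 2)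
    (hsm : ∀ i, Cerr i ≤ (4 / Real.pi ^ 2) ^ (P.d + 2) / (2 * (3 * (K i : ℝ) ^ 2 + 2 * (K i : ℝ) ^ 4)))
    (hγle : ∀ i, γ / (I i).M ^ 5 ≤ (4 / Real.pi ^ 2) ^ (P.d + 2) / (2 * (3 * (K i : ℝ) ^ 2 + 2 * (K i : ℝ) ^ 4)))
    (hH : ∀ i Vk x, ‖H i Vk x‖ ≤ h₁ * ‖x‖) (hHst : ∀ i Vk z, ‖Hst i Vk z‖ ≤ hst * ‖z‖)
    (hdV0 : ∀ i Vk, dV i Vk 0 = 0)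
    (hdV : ∀ i Vk (u v : F i), ‖u‖ ≤ ρ i → ‖v‖ ≤ ρ i → ‖dV i Vk u - dV i Vk v‖ ≤ ℓ i * ‖u - v‖)
    (hρ : ∀ i, h₁ * r i ≤ ρ i) (hsmall : ∀ i, (I i).M ^ 5 / γ * hst * ℓ i * h₁ ≤ 1 / 2)
    (hA : ∀ i Vk (X δ : GaugeSlice (pts (I i).k (I i).Λ) (T i) (EuclideanSpace ℝ (Fin 3))),
      HasDerivAt (fun s : ℝ => (I i).f (expMul su2Chart (ιA (pts (I i).k (I i).Λ) (T i) (X + s • δ)) (ext i Vk)))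
      (⟪δ, Hst i Vk (J i Vk)⟫ + ⟪δ, Hst i Vk (Δ₁ i Vk (H i Vk X))⟫ + ⟪δ, Hst i Vk (dV i Vk (H i Vk X))⟫) 0)
    (hJ : ∀ i ε Vk, 0 < ε → (lfVarOn su2Chart I).Regular i ε Vk → ‖J i Vk‖ ≤ cJ * ε)
    (hc3 : ∀ i Vk (B : GaugeSlice (pts (I i).k (I i).Λ) (T i) (EuclideanSpace ℝ (Fin 3))), ‖B‖ ≤ r i →
      (IsCriticalPt su2Chart (bondsOf (pts (I i).k (I i).Λ)) (I i).f
          (expMul su2Chart (ιA (pts (I i).k (I i).Λ) (T i) B) (ext i Vk)) ↔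
        ∀ δB : GaugeSlice (pts (I i).k (I i).Λ) (T i) (EuclideanSpace ℝ (Fin 3)),
          ⟪δB, Hst i Vk (J i Vk)⟫ + ⟪δB, Hst i Vk (Δ₁ i Vk (H i Vk B))⟫ + ⟪δB, Hst i Vk (dV i Vk (H i Vk B))⟫ = 0))
    (hc3'' : ∀ i (u : GaugeTransf P (I i).k SU2) (V : GaugeField P (I i).k SU2), IsGaugeOn (pts (I i).k (I i).Λ) u →
      (I i).f (gaugeAct u V) = (I i).f V)
    (hAn : ∀ i ε Vk, 0 < ε → ε ≤ eA i → (lfVarOn su2Chart I).Regular i ε Vk → (I i).An ε Vk)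
    (hdom : ∀ i, (I i).dom = domReg (I i).Z (I i).k (a₁ i))
    -- thresholds (`N i = √|free bonds|`)
    (hN' : ∀ i, Real.sqrt (freeBonds (pts (I i).k (I i).Λ) (T i)).card * (π / 2 * δc i) ≤ r i)
    (hδ : ∀ i ε, 0 < ε → ε ≤ eD i →
      ((n i : ℝ) + 2) * ((n i : ℝ) + P.d) * (a₁ i + (bx * (I i).M ^ 2 * ε + ε)) < δc i)
    (he1 : ∀ i ε, 0 < ε → ε ≤ eD i → (4 * 1 * (2 * (I i).M ^ 5 * hst * cJ / γ) + bx * (I i).M ^ 2) * ε < a₁ i) :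
    B15.Prop1Printed (lfVarOn su2Chart I) := by

  refine prop1Printed_lfVarOn_su2_box_G0_of_17_ext193 hd3 h0 I T H Hst hadj Δ₁ dV J lo hi n hn hN hbox hZ hTG0 hN5 K hK1 hKn
    ext hext hlohi hγ (by positivity) hh₁ hhst hcJ hbx hbxM hℓ hr heA heD hδc ha₁ hM ?_ hsm hγle hH hHst hdV0 hdV hρ hsmall
    hA hJ hc3 hc3'' hAn hdom hN' hδ he1
  intro i Vk X
  have hm : ∀ κ, (((hi i κ - lo i κ + 1).toNat + 3 : ℕ) : ℤ) ≤ P.sitesPerDir (I i).k := fun κ => by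
    have h5 := hN5 i κ
    push_cast
    linarith
  exact ineq17_of_lead (hlead i Vk X)
    (circ_le_sum_formDk h0 (hn' i) (fun κ => lo i κ - 2) hm (ιA (pts (I i).k (I i).Λ) (T i) X))

end Knit

end Literature.MathematicalPhysics.QuantumFieldTheory.Balaban1983to89.B15Prop1SliceIneq167

end
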